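import Summits.AtomisticToContinuum.Crystallization.Theses.ChessboardParticlePlanes
import Summits.AtomisticToContinuum.Crystallization.Theorems.ChargedEnergyGap.Negative.Unconditional
import Literature.MathematicalPhysics.StatisticalMechanics.LocalMatchingCompactness
import Literature.MathematicalPhysics.StatisticalMechanics.BarlowStacking

/-!
# Crux `PeriodicWindows` (stmt-AtomisticToContinuum-3240), line `Sketch` — hcp windows from bilayer coercivity

Helper for the lead skeleton `PeriodicWindowsSketch` (rev 7, route `ChessboardParticlePlanes`). The planar stub of
the line (rev-4/5/6 `stub_hcpWindowsOfBulkOptimal`: a bulk-optimal, dense, separated PERIOD-2 STACK has hcp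
windows of every size) is reduced to the B-INEQUALITY of bilayer coercivity (rev-7 stub `stub_bilayerCoercivity`,
the route's foreseen `LjBilayerCoercive` = crux `LjBilayerHcp` 6710 with a defect-counting margin, hull-free):
`2 e(hcp a h)·#(X ∩ B̄_L(c)) + κ(R,η)·#{(R,η)-hcp-bad points in B̄_L(c)} − C (L+1)² ≤ Σ_{y ∈ X ∩ B̄_L(c)} Σ'_{z ≠ y} V_LJ`.
`hcpWindows_of_bilayerCoercivity` (proved here) combines it with the bulk-optimality E-inequality
`Σ ≤ 2 e_∞·# + εL³`: since `e_∞ = liminf E(N)/N = ⨅_Q e(Q) ≤ e(hcp a h)` (`crysEnergyLimit`, item 0626, and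
`eStar_le`, item 0714), the real bookkeeping of item 12091 (`defectDensity_bookkeeping`, adapted from
`hullDefectDensityZero_bookkeeping`) makes the bad points `θ`-sparse in `B̄(0, 2L)`; a cubic grid of `M³` disjoint
`ρ₀`-balls, each holding a point of the `ρ₀`-dense `X` (`exists_good_of_few_bad`), then produces an
`(R,η)`-hcp-good point `y ∈ X`, whose chart (a linear isometry, upgraded to an equivalence) is the hcp window.
-/

noncomputable section

namespace Summit.AtomisticToContinuum.Crystallization.Theorems.PeriodicWindowsSketch

open Literature.MathematicalPhysics.StatisticalMechanics Filter Metric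

/-- Coordinates are `1`-Lipschitz: `|p l - q l| ≤ dist p q` in `ℝ³`. -/
private theorem coord_sub_le_dist'' (p q : EuclideanSpace ℝ (Fin 3)) (l : Fin 3) :
    |p l - q l| ≤ dist p q := by
  rw [← Real.dist_eq]
  exact PiLp.dist_apply_le p q l

/-- A point of `ℝ³` all of whose coordinates are bounded by `b ≥ 0` in absolute value has norm
`≤ 2 b` (crude: `√3 ≤ 2`). -/
private theorem norm_toLp_le' (f : Fin 3 → ℝ) {b : ℝ} (hb : 0 ≤ b) (hf : ∀ l, |f l| ≤ b) :
    ‖(WithLp.toLp 2 f : EuclideanSpace ℝ (Fin 3))‖ ≤ 2 * b := by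
  have hsq : ‖(WithLp.toLp 2 f : EuclideanSpace ℝ (Fin 3))‖ ^ 2 ≤ (2 * b) ^ 2 := by
    rw [PiLp.norm_sq_eq_of_L2]
    simp only [Real.norm_eq_abs, sq_abs, Fin.sum_univ_three]
    have h0 := hf 0
    have h1 := hf 1
    have h2 := hf 2
    rw [abs_le] at h0 h1 h2
    nlinarith
  exact (pow_le_pow_iff_left₀ (norm_nonneg _) (by positivity) two_ne_zero).1 hsq

/-- **Many points in a big ball.** A `ρ₀`-dense set has, for `ρ' = max ρ₀ 1`, `L = 4ρ'M`, at least
`M³` points in `B̄(0, 2L)` (one near each centre of a cubic grid of spacing `4ρ'`), and these are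
distinct; so every subset of `X ∩ B̄(0, 2L)` of cardinality `< M³`... stated as: if a property fails
for at most `θ (2L)³ = M³/2` points of `X ∩ B̄(0,2L)` (`θ = 1/(1024ρ'³)`), some point of `X` in
`B̄(0, 2L)` has the property. -/
private theorem exists_good_of_few_bad {X : Set (EuclideanSpace ℝ (Fin 3))} {ρ₀ : ℝ}
    (hdense : ∀ c : EuclideanSpace ℝ (Fin 3), ∃ p ∈ X, dist p c ≤ ρ₀)
    (P : EuclideanSpace ℝ (Fin 3) → Prop) {M : ℕ} (hM1 : 1 ≤ M)
    (hfin : ({p | p ∈ X ∧ dist p 0 ≤ 2 * (4 * max ρ₀ 1 * M) ∧ ¬ P p} : Set _).Finite)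
    (hfew : (({p | p ∈ X ∧ dist p 0 ≤ 2 * (4 * max ρ₀ 1 * M) ∧ ¬ P p} : Set _).ncard : ℝ) ≤
      1 / (1024 * (max ρ₀ 1) ^ 3) * (2 * (4 * max ρ₀ 1 * M)) ^ 3) :
    ∃ p ∈ X, dist p 0 ≤ 2 * (4 * max ρ₀ 1 * M) ∧ P p := by
  classical
  set ρ' : ℝ := max ρ₀ 1 with hρ'def
  have hρ'1 : 1 ≤ ρ' := le_max_right _ _
  have hρ'0 : 0 < ρ' := by linarith
  have hρρ' : ρ₀ ≤ ρ' := le_max_left _ _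
  set L : ℝ := 4 * ρ' * M with hLdef
  have hM1' : (1 : ℝ) ≤ M := by exact_mod_cast hM1
  have hLρ : 4 * ρ' ≤ L := by rw [hLdef]; nlinarith
  -- the grid
  choose f hfX hfd using hdense
  set a : Fin M → ℝ := fun m => 4 * ρ' * m + 2 * ρ' - L / 2 with hadef
  have ha_abs : ∀ m : Fin M, |a m| ≤ L / 2 := by
    intro m
    have hm0 : (0 : ℝ) ≤ (m : ℕ) := Nat.cast_nonneg _
    have hm1 : ((m : ℕ) : ℝ) + 1 ≤ M := by exact_mod_cast m.2
    rw [abs_le, hadef]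
    dsimp only
    constructor <;> nlinarith
  have ha_sep : ∀ m m' : Fin M, m ≠ m' → 4 * ρ' ≤ |a m - a m'| := by
    intro m m' hne
    have hsub : a m - a m' = 4 * ρ' * ((m : ℕ) - (m' : ℕ) : ℝ) := by rw [hadef]; dsimp only; ring
    rw [hsub, abs_mul, abs_of_pos (by positivity : (0 : ℝ) < 4 * ρ')]
    have hz : (1 : ℝ) ≤ |((m : ℕ) : ℝ) - ((m' : ℕ) : ℝ)| := by
      have hne' : (m : ℕ) ≠ (m' : ℕ) := fun h => hne (Fin.ext h)
      rcases Nat.lt_or_gt_of_ne hne' with h | h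
      · have : ((m : ℕ) : ℝ) + 1 ≤ ((m' : ℕ) : ℝ) := by exact_mod_cast h
        rw [abs_of_neg (by linarith)]
        linarith
      · have : ((m' : ℕ) : ℝ) + 1 ≤ ((m : ℕ) : ℝ) := by exact_mod_cast h
        rw [abs_of_pos (by linarith)]
        linarith
    nlinarith
  set g : (Fin 3 → Fin M) → EuclideanSpace ℝ (Fin 3) :=
    fun i => WithLp.toLp 2 (fun l => a (i l)) with hgdef
  have hg_apply : ∀ i l, g i l = a (i l) := fun i l => rfl
  have hg_norm : ∀ i, ‖g i‖ ≤ L := fun i =>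
    (norm_toLp_le' _ (by positivity) fun l => ha_abs (i l)).trans (by linarith)
  set F : (Fin 3 → Fin M) → EuclideanSpace ℝ (Fin 3) := fun i => f (g i) with hFdef
  have hFinj : Function.Injective F := by
    intro i i' hii'
    by_contra hne
    obtain ⟨l, hl⟩ : ∃ l, i l ≠ i' l := by
      by_contra hall
      push Not at hall
      exact hne (funext hall)
    have h1 : dist (g i) (g i') ≤ 2 * ρ' :=
      calc dist (g i) (g i') ≤ dist (f (g i)) (g i) + dist (f (g i)) (g i') :=
            dist_triangle_left _ _ _
        _ = dist (f (g i)) (g i) + dist (f (g i')) (g i') := by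
            show dist (F i) (g i) + dist (F i) (g i') = dist (F i) (g i) + dist (F i') (g i')
            rw [hii']
        _ ≤ ρ₀ + ρ₀ := add_le_add (hfd _) (hfd _)
        _ ≤ 2 * ρ' := by linarith
    have h2 : 4 * ρ' ≤ dist (g i) (g i') :=
      calc 4 * ρ' ≤ |a (i l) - a (i' l)| := ha_sep _ _ hl
        _ = |g i l - g i' l| := by rw [hg_apply, hg_apply]
        _ ≤ dist (g i) (g i') := coord_sub_le_dist'' _ _ _
    linarith
  have hFball : ∀ i, dist (F i) 0 ≤ 2 * L := fun i =>
    calc dist (f (g i)) 0 ≤ dist (f (g i)) (g i) + dist (g i) 0 := dist_triangle _ _ _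
      _ ≤ ρ₀ + L := add_le_add (hfd _) (by rw [dist_zero_right]; exact hg_norm i)
      _ ≤ 2 * L := by linarith
  -- if every grid particle were bad we would have `M³ ≤ M³/2`
  by_contra hno
  push Not at hno
  set S : Set (EuclideanSpace ℝ (Fin 3)) := {p | p ∈ X ∧ dist p 0 ≤ 2 * L ∧ ¬ P p} with hSdef
  have himg : ↑(Finset.univ.image F) ⊆ S := by
    intro p hp
    rw [Finset.coe_image, Finset.coe_univ, Set.image_univ] at hp
    obtain ⟨i, rfl⟩ := hp
    exact ⟨hfX _, hFball i, hno _ (hfX _) (hFball i)⟩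
  have hcard : ((M : ℝ) ^ 3) ≤ (S.ncard : ℝ) := by
    have h1 : (Finset.univ.image F).card = M ^ 3 := by
      rw [Finset.card_image_of_injective _ hFinj, Finset.card_univ, Fintype.card_fun,
        Fintype.card_fin, Fintype.card_fin]
    have h2 : (Finset.univ.image F).card ≤ S.ncard := by
      rw [← Set.ncard_coe_finset]
      exact Set.ncard_le_ncard himg hfin
    rw [h1] at h2
    exact_mod_cast h2
  have hθL : 1 / (1024 * ρ' ^ 3) * (2 * L) ^ 3 = (M : ℝ) ^ 3 / 2 := by
    rw [hLdef]
    field_simp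
    ring
  have hM3 : (1 : ℝ) ≤ (M : ℝ) ^ 3 := one_le_pow₀ hM1'
  have := hcard.trans hfew
  rw [hθL] at this
  linarith

/-- Real-algebra core (adapted from `hullDefectDensityZero_bookkeeping`, route
`HullExactificationCascade`, item 12091): if `2en + κD − C(L+1)² ≤ T ≤ 2ℓn + (κθ/2)L³` with
`κ, θ > 0`, `n ≥ 0`, `ℓ ≤ e`, `L ≥ 1` and `16·max(C,0)/(κθ) ≤ L`, then `D ≤ θL³`. -/
private theorem defectDensity_bookkeeping {κ θ C n D T ℓ e L : ℝ}
    (hlow : 2 * e * n + κ * D - C * (L + 1) ^ 2 ≤ T)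
    (hup : T ≤ 2 * ℓ * n + κ * θ / 2 * L ^ 3)
    (hκ : 0 < κ) (hθ : 0 < θ) (hn : 0 ≤ n) (hℓ : ℓ ≤ e) (hL1 : 1 ≤ L)
    (hLC : 16 * max C 0 / (κ * θ) ≤ L) : D ≤ θ * L ^ 3 := by
  have hκθ : 0 < κ * θ := mul_pos hκ hθ
  have hM0 : 0 ≤ max C 0 := le_max_right _ _
  have hL0 : 0 ≤ L := le_trans zero_le_one hL1
  have h1 : 2 * ℓ * n ≤ 2 * e * n := by nlinarith
  have h2 : C * (L + 1) ^ 2 ≤ max C 0 * (L + 1) ^ 2 :=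
    mul_le_mul_of_nonneg_right (le_max_left C 0) (sq_nonneg _)
  have h3 : (L + 1) ^ 2 ≤ 4 * L ^ 2 := by nlinarith
  have h4 : max C 0 * (L + 1) ^ 2 ≤ max C 0 * (4 * L ^ 2) := mul_le_mul_of_nonneg_left h3 hM0
  have h5 : 16 * max C 0 ≤ κ * θ * L := by
    have h := (div_le_iff₀ hκθ).mp hLC
    linarith
  have h6 : max C 0 * (4 * L ^ 2) ≤ κ * θ / 2 * L ^ 3 := by
    have h5' : 16 * max C 0 * L ^ 2 ≤ κ * θ * L * L ^ 2 :=
      mul_le_mul_of_nonneg_right h5 (sq_nonneg L)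
    have hML : 0 ≤ max C 0 * L ^ 2 := mul_nonneg hM0 (sq_nonneg L)
    nlinarith [h5', hML]
  have h7 : κ * D ≤ κ * (θ * L ^ 3) := by nlinarith [hlow, hup, h1, h2, h4, h6]
  exact le_of_mul_le_mul_left h7 hκ

/-- `liminf E(N)/N ≤ e(Q)` for every periodic configuration `Q` of `ℝ³` (Lennard-Jones): the
thermodynamic limit is the periodic infimum (`crysEnergyLimit`, item 0626) and the infimum is a
genuine one (`eStar_le`, item 0714). -/
private theorem liminf_groundStateEnergy_div_le (Q : PeriodicConfiguration 3) :
    Filter.liminf (fun N : ℕ => groundStateEnergy lennardJones 3 N / (N : ℝ)) Filter.atTop ≤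
      Q.energyPerParticle lennardJones := by
  rw [ChargedEnergyGapNegative.crysEnergyLimit.liminf_eq]
  exact ChargedEnergyGapNegative.eStar_le Q

/-- **G3a (proved): hcp windows from bilayer coercivity.** If a `7/10`-separated, relatively dense
`X ⊆ ℝ³` satisfies, for some relaxed hcp `hcpStacking a h` with `(a, h) ∈ [1/2, 2]²`, the
B-INEQUALITY "`2 e(hcp a h)·#(X ∩ B̄_L(c)) + κ(R,η)·#{(R,η)-hcp-bad points of X in B̄_L(c)}
− C (L+1)² ≤ Σ_{y ∈ X ∩ B̄_L(c)} Σ'_{z ∈ X, z ≠ y} V_LJ(|y − z|)`" (conclusion of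
`stub_bilayerCoercivity` for this `X`) and the bulk-optimality E-inequality, then `X` has hcp
windows of every size: bookkeeping (`defectDensity_bookkeeping`, with `liminf E(N)/N ≤ e(hcp a h)`)
makes the bad points `θ`-sparse, a grid count (`exists_good_of_few_bad`) produces an `(R,η)`-good
point `y ∈ X`, and its chart `A` (upgraded to a linear isometry equivalence) is the window. -/
theorem hcpWindows_of_bilayerCoercivity (X : Set (EuclideanSpace ℝ (Fin 3))) {a h : ℝ}
    (ha : a ≠ 0) (hh : h ≠ 0) (ha1 : 1 / 2 ≤ a) (ha2 : a ≤ 2) (hh1 : 1 / 2 ≤ h) (hh2 : h ≤ 2)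
    (hsep : ∀ p ∈ X, ∀ q ∈ X, p ≠ q → (7 : ℝ) / 10 ≤ dist p q)
    (hdense : ∃ ρ₀ : ℝ, ∀ c : EuclideanSpace ℝ (Fin 3), ∃ p ∈ X, dist p c ≤ ρ₀)
    (hcoer : ∀ R η : ℝ, 0 < R → 0 < η → ∃ κ : ℝ, 0 < κ ∧ ∃ C : ℝ,
      ∀ (c₀ : EuclideanSpace ℝ (Fin 3)) (L : ℝ), 0 ≤ L →
        2 * ((hcpPeriodicConfiguration ha hh).energyPerParticle lennardJones) *
            (({y : EuclideanSpace ℝ (Fin 3) | y ∈ X ∧ dist y c₀ ≤ L} :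
              Set (EuclideanSpace ℝ (Fin 3))).ncard : ℝ) +
          κ * (({y : EuclideanSpace ℝ (Fin 3) | y ∈ X ∧ dist y c₀ ≤ L ∧
            ¬ (∃ A : EuclideanSpace ℝ (Fin 3) →ₗᵢ[ℝ] EuclideanSpace ℝ (Fin 3),
              (∀ p ∈ hcpStacking a h, ‖p‖ ≤ R → ∃ z ∈ X, dist z (y + A p) ≤ η) ∧
              (∀ z ∈ X, dist z y ≤ R → ∃ p ∈ hcpStacking a h, dist z (y + A p) ≤ η))} :
              Set (EuclideanSpace ℝ (Fin 3))).ncard : ℝ) -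
          C * (L + 1) ^ 2 ≤
        (∑' y : ↥{y : EuclideanSpace ℝ (Fin 3) | y ∈ X ∧ dist y c₀ ≤ L},
          (∑' z : ↥{z : EuclideanSpace ℝ (Fin 3) | z ∈ X ∧ z ≠ (y : EuclideanSpace ℝ (Fin 3))},
            lennardJones (dist (y : EuclideanSpace ℝ (Fin 3)) (z : EuclideanSpace ℝ (Fin 3))))))
    (hbulk : ∀ ε : ℝ, 0 < ε → ∃ L₀ : ℝ, ∀ L : ℝ, L₀ ≤ L → ∀ c : EuclideanSpace ℝ (Fin 3),
      (∑' y : ↥{y : EuclideanSpace ℝ (Fin 3) | y ∈ X ∧ dist y c ≤ L},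
        (∑' z : ↥{z : EuclideanSpace ℝ (Fin 3) | z ∈ X ∧ z ≠ (y : EuclideanSpace ℝ (Fin 3))},
          lennardJones (dist (y : EuclideanSpace ℝ (Fin 3)) (z : EuclideanSpace ℝ (Fin 3))))) ≤
      2 * (Filter.liminf (fun N : ℕ => groundStateEnergy lennardJones 3 N / (N : ℝ)) Filter.atTop) *
        (({y : EuclideanSpace ℝ (Fin 3) | y ∈ X ∧ dist y c ≤ L} : Set (EuclideanSpace ℝ (Fin 3))).ncard : ℝ) +
      ε * L ^ 3) :
    ∀ R η : ℝ, 0 < η → ∃ (c : EuclideanSpace ℝ (Fin 3)) (a' h' : ℝ)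
      (B : EuclideanSpace ℝ (Fin 3) ≃ₗᵢ[ℝ] EuclideanSpace ℝ (Fin 3)),
      1 / 2 ≤ a' ∧ a' ≤ 2 ∧ 1 / 2 ≤ h' ∧ h' ≤ 2 ∧
        BallMatch η R c X ((fun q => B q + c) '' hcpStacking a' h') := by
  classical
  intro R η hη
  -- work at radius `R' = max R 1 > 0`
  set R' : ℝ := max R 1 with hR'def
  have hR'0 : 0 < R' := lt_of_lt_of_le one_pos (le_max_right _ _)
  have hRR' : R ≤ R' := le_max_left _ _
  obtain ⟨κ, hκ, C, hB⟩ := hcoer R' η hR'0 hη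
  obtain ⟨ρ₀, hρ₀⟩ := hdense
  set ρ' : ℝ := max ρ₀ 1 with hρ'def
  have hρ'1 : 1 ≤ ρ' := le_max_right _ _
  have hρ'0 : 0 < ρ' := by linarith
  -- density `θ` of bad points that the grid count tolerates, and the bulk tolerance `ε = κθ/2`
  set θ : ℝ := 1 / (1024 * ρ' ^ 3) with hθdef
  have hθ : 0 < θ := by positivity
  obtain ⟨L₁, hL₁⟩ := hbulk (κ * θ / 2) (by positivity)
  -- the scale `2L = 2·4ρ'M ≥ max L₁ 1 ⊔ 16 max(C,0)/(κθ)`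
  set Lneed : ℝ := max L₁ (max 1 (16 * max C 0 / (κ * θ))) with hLneed
  obtain ⟨M, hM1, hML⟩ : ∃ M : ℕ, 1 ≤ M ∧ Lneed ≤ 2 * (4 * ρ' * M) := by
    refine ⟨max 1 ⌈Lneed / (8 * ρ')⌉₊, le_max_left _ _, ?_⟩
    have h1 : Lneed / (8 * ρ') ≤ ⌈Lneed / (8 * ρ')⌉₊ := Nat.le_ceil _
    have h2 : (⌈Lneed / (8 * ρ')⌉₊ : ℝ) ≤ ((max 1 ⌈Lneed / (8 * ρ')⌉₊ : ℕ) : ℝ) := by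
      exact_mod_cast le_max_right _ _
    rw [div_le_iff₀ (by positivity)] at h1
    nlinarith
  set L2 : ℝ := 2 * (4 * ρ' * M) with hL2def
  have hL₁L : L₁ ≤ L2 := (le_max_left _ _).trans hML
  have h1L : 1 ≤ L2 := ((le_max_left _ _).trans (le_max_right _ _)).trans hML
  have hCL : 16 * max C 0 / (κ * θ) ≤ L2 := ((le_max_right _ _).trans (le_max_right _ _)).trans hML
  -- the good-point predicate at `(R', η)`
  set Good : EuclideanSpace ℝ (Fin 3) → Prop := fun y =>
    ∃ A : EuclideanSpace ℝ (Fin 3) →ₗᵢ[ℝ] EuclideanSpace ℝ (Fin 3),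
      (∀ p ∈ hcpStacking a h, ‖p‖ ≤ R' → ∃ z ∈ X, dist z (y + A p) ≤ η) ∧
      (∀ z ∈ X, dist z y ≤ R' → ∃ p ∈ hcpStacking a h, dist z (y + A p) ≤ η) with hGood
  -- bookkeeping: the bad points of `B̄(0, L2)` are `θ`-sparse
  have hD : (({p | p ∈ X ∧ dist p 0 ≤ L2 ∧ ¬ Good p} : Set (EuclideanSpace ℝ (Fin 3))).ncard : ℝ) ≤
      θ * L2 ^ 3 :=
    defectDensity_bookkeeping (hB 0 L2 (zero_le_one.trans h1L)) (hL₁ L2 hL₁L 0) hκ hθ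
      (Nat.cast_nonneg _) (liminf_groundStateEnergy_div_le _) h1L hCL
  -- the grid count gives a good point of `X`
  have hfin : ({p | p ∈ X ∧ dist p 0 ≤ L2 ∧ ¬ Good p} : Set (EuclideanSpace ℝ (Fin 3))).Finite := by
    refine finite_of_forall_le_dist_of_subset_closedBall (by norm_num : (0 : ℝ) < 7 / 10)
      (fun p hp q hq hpq => hsep p hp.1 q hq.1 hpq) (c := 0) (R := L2) ?_
    intro p hp
    exact mem_closedBall.2 hp.2.1
  obtain ⟨y, hyX, -, A, hA1, hA2⟩ := exists_good_of_few_bad hρ₀ Good hM1 hfin (by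
    rw [hθdef] at hD; exact hD)
  -- the window: upgrade `A` to a linear isometry equivalence
  set B : EuclideanSpace ℝ (Fin 3) ≃ₗᵢ[ℝ] EuclideanSpace ℝ (Fin 3) :=
    A.toLinearIsometryEquiv rfl with hBdef
  have hBA : ∀ p, B p = A p := fun p => LinearIsometry.toLinearIsometryEquiv_apply A rfl p
  refine ⟨y, a, h, B, ha1, ha2, hh1, hh2, BallMatch.mono ?_ le_rfl hRR'⟩
  refine ⟨?_, ?_⟩
  · rintro _ ⟨p, hp, rfl⟩ hpR
    have hnorm : ‖p‖ ≤ R' := by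
      have : dist (B p + y) y = ‖p‖ := by
        rw [dist_eq_norm, add_sub_cancel_right, B.norm_map]
      rwa [this] at hpR
    obtain ⟨z, hz, hzp⟩ := hA1 p hp hnorm
    refine ⟨z, hz, ?_⟩
    show dist z (B p + y) ≤ η
    rwa [hBA, add_comm]
  · intro z hz hzR
    obtain ⟨p, hp, hzp⟩ := hA2 z hz hzR
    refine ⟨B p + y, ⟨p, hp, rfl⟩, ?_⟩
    rwa [hBA, add_comm]

end Summit.AtomisticToContinuum.Crystallization.Theorems.PeriodicWindowsSketch

end
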